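import Literature.Barriers.SmoothPoincare4.SmallExoticaFrontierReductionLemma8BlocksProofs
import Literature.Topology.FourManifolds.TubeRegluing
import Literature.Topology.FourManifolds.TubeRegluingRotation
import Literature.Topology.FourManifolds.CircleNbhdTransport
import Literature.Topology.FourManifolds.SmoothOrientationGluing
import HarnessLib

/-!
# Akhmedov–Park 2010, Lemma 8: the surgery steps and the fibre sum EXIST (smooth blocks)

Proof file (theorems only, no definition, no named fact) continuing
`SmallExoticaFrontierReductionLemma8BlocksProofs.lean` for the Seiberg–Witten leaf
`Literature.Barriers.SmoothPoincare4.akhmedovPark2010_lemma8_invariants` (A. Akhmedov,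
B. D. Park, *Exotic smooth structures on small 4-manifolds with odd signatures*, Invent. Math. 181
(2010) 577–603, §9 Lemma 8).  §12 and §13 of that file take the torus-surgered blocks `P` and the
fibre sum `X m` as HYPOTHESES (any regluing `BoundaryGluingData … P`, any gluing `G m`); the
existence theorems `exists_tubeRegluing_boundaryGluingData` (`TubeRegluing.lean`: a tube
reglued by a fibred conical diffeomorphism) and `exists_fibreSum_boundaryGluingData`
(`TubeFibreSum.lean`) now PRODUCE them from SMOOTH tubes.  This file threads the two together
in the smooth category, where tubes are smooth open embeddings `F × ℝ² → Y` and stay smooth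
through the surgeries:

* §14 `isSmoothEmbedding_comp_of_isOpen_range_of_isSmoothEmbedding` — **transport of smooth
  tubes**: an open smooth embedding `ι : A → P` of `4`-manifolds composed with a smooth embedding
  `g : Q → A` (any model, e.g. a tube `F × ℝ²`) is a smooth embedding, with open range if `g`
  has (`rangeDiffeomorph` + `IsSmoothEmbedding.diffeomorph_comp` + `subtypeVal_comp`);
* §15 `akhmedovPark2010_lemma8_smooth_block_step` — **one torus surgery step EXISTS and
  preserves the block data**: for a closed connected `ℤ`-orientable smooth `4`-manifold `Y` all
  of whose orientations have `|σ| = n`, a smooth surgery tube `T' : F' × ℝ² → Y` (`F'` a closed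
  connected surface with finitely generated homology) and a fibred conical regluing pair
  `Ψ, Ψ'`, there IS a closed connected `ℤ`-orientable smooth `4`-manifold `P` — `Y` with the
  tube reglued by `Ψ` — with `|σ| = n` for all its orientations and `e(P) = e(Y)`
  (§12's invariance theorems `isOrientableOver_int_of_tube_regluing`,
  `exists_signature_eq_of_tube_regluing`, `relEuler_eq_of_tube_regluing` applied to the gluing
  data of `exists_tubeRegluing_boundaryGluingData`), together with the open smooth embedding
  `ι : Y ∖ T'(F' × 0) → P` of the complement of the core, through which every smooth tube of
  `Y` missing the core is carried to a smooth tube of `P` (§14) — in Akhmedov–Park's words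
  (§2, §4, §9): "the surfaces `Σ₂ × {pt}` … descend to surfaces in `Yₙ(m)`", "`Σ̄₂` is still a
  submanifold of `Z''(1/q, m/r)`", "`Σ₂ ⊂ Y₁(1/p, 1/q)` is disjoint from the neighborhoods of
  the four Luttinger surgery tori";
* §15′ `akhmedovPark2010_lemma8_rotation_block_step` — the same for the **rotation regluings**
  `(f, v) ↦ (f, χ(f) · v)` of a smooth `χ : F' → S¹` (`TubeRegluingRotation.lean`): the gluing
  maps of the Luttinger surgeries `(T, γ, ±1)` and of the `m`-torus surgery of `Z''(1, m)`
  (`χ` = a power of the angular coordinate of `T²` dual to `γ`), with no hypothesis on the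
  regluing left;
* §16 `akhmedovPark2010_lemma8_exists_fibreSum_of_smooth_blocks` — **the fibre sum of two smooth
  blocks EXISTS with the data of §13**: for smooth tubes `T₁ : F × ℝ² → Y₁`, `T₂ : F × ℝ² → Y₂`
  of one closed surface `F` in two closed smooth `4`-manifolds there are tube functions, a closed
  smooth `X`, `ψ` and `G : BoundaryGluingData … ψ X` — the slots `(gᵢ m, X m, ψ m, G m)` of
  `akhmedovPark2010_lemma8_invariants_of_blocks_vanKampen` (a restatement of `exists_fibreSum`
  in the universe and shape used there).

What is NOT supplied (unchanged): the paper-specific smooth tubes (the product tube of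
`Σ₂ × {pt}` is `exists_surface_prod_torus_smooth_tube`; the four Lagrangian tori of eq. (9.1) in
`Σ₂ × T²`, the surface `Σ̄₂ ⊂ T⁴ # ℂℙ²bar` of §3 and the two tori of eq. (4.1) are not in the
tree; the angular coordinates `χ` of the surgery tori come with them), the presentations of
the fundamental groups (§§5–9 of the paper), and the Seiberg–Witten invariants.

## References

* [AkhmedovPark2010] A. Akhmedov, B. D. Park, Invent. Math. 181 (2010) 577–603 =
  arXiv:math/0701829: §2, §4, §9 (Lemma 8 and its proof).
* [GompfStipsiczGSM1999] R. E. Gompf, A. I. Stipsicz, *4-Manifolds and Kirby Calculus*, GSM 20,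
  AMS 1999, §7.1 (fibre sums), §8.3 p. 311 (torus surgery).
* [Gompf1995] R. E. Gompf, Ann. of Math. 142 (1995), §1 (the fibre sum).
* [BaldridgeKirk2008] S. Baldridge, P. Kirk, Geom. Topol. 12 (2008) 919–940, §2.2 (the gluing
  map of a `p/q` torus surgery).
-/

noncomputable section

open scoped Manifold ContDiff
open Set Module
open Literature.AlgebraicTopology.SingularHomology
open Literature.Topology.FourManifolds

namespace Literature.Barriers.SmoothPoincare4

/-! ### §14 Transport of smooth tubes through an open smooth embedding -/

/-- **An open smooth embedding followed by a smooth embedding is a smooth embedding.**  For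
manifolds `A`, `P` modelled on `ℝᵏ⁺¹`, an open smooth embedding `ι : A → P` and a smooth
embedding `g : Q → A` from a manifold with any (real) model, `ι ∘ g` is a smooth embedding, and
its range is open when the range of `g` is: `ι` is a diffeomorphism onto the open submanifold
`range ι` (`rangeDiffeomorph`), and `ι ∘ g = val ∘ (rangeDiffeomorph ∘ g)`
(`IsSmoothEmbedding.diffeomorph_comp`, `IsSmoothEmbedding.subtypeVal_comp`).  This carries the
smooth tubes of `Y ∖ T'(F' × 0)` to smooth tubes of the reglued manifold `P` of
`exists_tubeRegluing_boundaryGluingData` (through its `ι`). [folklore] -/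
theorem isSmoothEmbedding_comp_of_isOpen_range_of_isSmoothEmbedding {k : ℕ}
    {EQ HQ : Type*} [NormedAddCommGroup EQ] [NormedSpace ℝ EQ] [TopologicalSpace HQ]
    {IQ : ModelWithCorners ℝ EQ HQ} {Q : Type*} [TopologicalSpace Q] [ChartedSpace HQ Q]
    [IsManifold IQ ∞ Q]
    {A : Type*} [TopologicalSpace A] [ChartedSpace (EuclideanSpace ℝ (Fin (k + 1))) A]
    [IsManifold (𝓡 (k + 1)) ∞ A]
    {P : Type*} [TopologicalSpace P] [ChartedSpace (EuclideanSpace ℝ (Fin (k + 1))) P]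
    [IsManifold (𝓡 (k + 1)) ∞ P]
    {ι : A → P} (hι : Manifold.IsSmoothEmbedding (𝓡 (k + 1)) (𝓡 (k + 1)) ∞ ι)
    (hιo : IsOpen (range ι)) {g : Q → A} (hg : Manifold.IsSmoothEmbedding IQ (𝓡 (k + 1)) ∞ g) :
    Manifold.IsSmoothEmbedding IQ (𝓡 (k + 1)) ∞ (ι ∘ g) ∧
      (IsOpen (range g) → IsOpen (range (ι ∘ g))) := by
  refine ⟨?_, fun hgo => ?_⟩
  · have h := (hg.diffeomorph_comp (rangeDiffeomorph hι hιo)).subtypeVal_comp (rangeOpens ι hιo)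
    exact h
  · rw [range_comp]
    exact (Topology.IsOpenEmbedding.mk hι.isEmbedding hιo).isOpenMap _ hgo

/-! ### §15 One torus surgery step EXISTS and preserves the block data -/

/-- **One torus surgery step on a block, in the smooth category: the reglued manifold exists and
has the same block data.**  Let `Y` be a closed connected `ℤ`-orientable smooth `4`-manifold all
of whose orientations have `|σ| = n`, `T' : F' × ℝ² → Y` a smooth open embedding (`F'` a closed
connected surface with finitely generated homology — the surgery torus), and `Ψ`, `Ψ'` mutually
inverse fibred regluing maps of `F' × (ℝ² ∖ 0)` (`C^∞` off the zero section, radius preserving,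
`Ψ` conical; e.g. a Luttinger or `m`-torus surgery).  Then there are a closed connected
`ℤ`-orientable smooth `4`-manifold `P` with `|σ| = n` for all its orientations and `e(P) = e(Y)`,
an open set `A = Y ∖ T'(F' × 0)` and an open smooth embedding `ι : A → P` — `P` is `Y` with the
tube `T'` reglued by `Ψ` (`exists_tubeRegluing_boundaryGluingData`), the block data passing by
`isOrientableOver_int_of_tube_regluing`, `exists_signature_eq_of_tube_regluing` (Novikov
additivity) and `relEuler_eq_of_tube_regluing`; smooth tubes of `Y` off the core of `T'` are
carried to smooth tubes `ι ∘ T₀` of `P`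
(`isSmoothEmbedding_comp_of_isOpen_range_of_isSmoothEmbedding`).  Akhmedov–Park 2010, §2
("the Euler characteristic of `Yₙ(m)` is `4n - 4` and its signature is `0`"), §4
("`e(Z') = e(Z''(1/q, m/r)) = 1` and `σ(Z') = σ(Z''(1/q, m/r)) = -1`").
[cite: AkhmedovPark2010, §2, §4 and §9] [cite: GompfStipsiczGSM1999, §8.3 p. 311] -/
theorem akhmedovPark2010_lemma8_smooth_block_step
    {Y : Type} [TopologicalSpace Y] [T2Space Y] [SecondCountableTopology Y] [CompactSpace Y]
    [ConnectedSpace Y] [ChartedSpace (EuclideanSpace ℝ (Fin 4)) Y] [IsManifold (𝓡 4) ∞ Y]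
    -- the surgery tube
    {F' : Type} [TopologicalSpace F'] [T2Space F'] [CompactSpace F'] [ConnectedSpace F']
    [ChartedSpace (EuclideanSpace ℝ (Fin 2)) F'] (hF' : FinRelHomology ℤ ℤ F' ∅ 4)
    {T' : F' × EuclideanSpace ℝ (Fin 2) → Y}
    (hT' : Manifold.IsSmoothEmbedding ((𝓡 2).prod (𝓡 2)) (𝓡 4) ∞ T') (hT'o : IsOpen (range T'))
    -- the regluing pair
    {Ψ Ψ' : F' × EuclideanSpace ℝ (Fin 2) → F' × EuclideanSpace ℝ (Fin 2)}
    (hΨ : ContMDiffOn ((𝓡 2).prod (𝓡 2)) ((𝓡 2).prod (𝓡 2)) ∞ Ψ {q | q.2 ≠ 0})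
    (hΨ' : ContMDiffOn ((𝓡 2).prod (𝓡 2)) ((𝓡 2).prod (𝓡 2)) ∞ Ψ' {q | q.2 ≠ 0})
    (hΨΨ' : ∀ q : F' × EuclideanSpace ℝ (Fin 2), q.2 ≠ 0 → Ψ (Ψ' q) = q)
    (hΨ'Ψ : ∀ q : F' × EuclideanSpace ℝ (Fin 2), q.2 ≠ 0 → Ψ' (Ψ q) = q)
    (hnΨ : ∀ q : F' × EuclideanSpace ℝ (Fin 2), q.2 ≠ 0 → ‖(Ψ q).2‖ = ‖q.2‖)
    (hnΨ' : ∀ q : F' × EuclideanSpace ℝ (Fin 2), q.2 ≠ 0 → ‖(Ψ' q).2‖ = ‖q.2‖)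
    (hcone : ∀ (f : F') (u : EuclideanSpace ℝ (Fin 2)), ‖u‖ = 1 → ∀ t : ℝ, 0 < t →
      Ψ (f, t • u) = ((Ψ (f, u)).1, t • (Ψ (f, u)).2))
    -- the numbers of `Y`
    (hY : IsOrientableOver ℤ Y 4) {n : ℕ}
    (hσ : ∀ ν : HomologicalOrientation ℤ Y 4, ν.signature.natAbs = n) :
    ∃ (P : Type) (_ : TopologicalSpace P) (_ : T2Space P) (_ : SecondCountableTopology P)
      (_ : CompactSpace P) (_ : ChartedSpace (EuclideanSpace ℝ (Fin 4)) P)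
      (_ : IsManifold (𝓡 4) ∞ P) (A : TopologicalSpace.Opens Y) (ι : A → P),
      ConnectedSpace P ∧ IsOrientableOver ℤ P 4 ∧
      (∀ ν : HomologicalOrientation ℤ P 4, ν.signature.natAbs = n) ∧
      relEuler ℤ ℤ P ∅ = relEuler ℤ ℤ Y ∅ ∧
      (A : Set Y) = (range fun f : F' => T' (f, 0))ᶜ ∧
      Manifold.IsSmoothEmbedding (𝓡 4) (𝓡 4) ∞ ι ∧ IsOpen (range ι) := by
  haveI : Nonempty F' := ConnectedSpace.toNonempty
  -- a tube function for the surgery tube, and the reglued manifold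
  obtain ⟨g', hreg', hle', hlt', hout'⟩ := exists_tube_function (k := 3) hT' hT'o
  obtain ⟨P, _, _, _, _, _, _, φ', GP, A, B, hA, hB, ι, ι', hAeq, -, -, hιe, hιo, -, -, -, -, -,
      -⟩ :=
    exists_tubeRegluing_boundaryGluingData (k := 3) two_pos hT' hT'o hreg' hle' hlt' hout' hΨ hΨ'
      hΨΨ' hΨ'Ψ hnΨ hnΨ' hcone
  have hT'e : Topology.IsEmbedding T' := hT'.isEmbedding
  -- the two pieces of the surgery as null-cobordisms of their boundaries (for connectedness)
  let bN := RegularSublevel.boundaryData hreg'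
  let bM := RegularSublevel.boundaryData hreg'.const_sub
  let cN : NullCobordism 3 bN.carrier :=
    { W := RegularSublevel hreg'
      incl := bN.incl
      isSmoothEmbedding_incl := bN.isSmoothEmbedding
      range_incl := bN.range_incl }
  let cM : NullCobordism 3 bM.carrier :=
    { W := RegularSuperlevel hreg'
      incl := bM.incl
      isSmoothEmbedding_incl := bM.isSmoothEmbedding
      range_incl := bM.range_incl }
  -- nonempty boundary (the level `T'(F' × S(0, ½))`)
  have hlevel : (g' ⁻¹' {1 / 4}).Nonempty := by
    rw [level_eq_image_tube hle' hlt' hout']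
    obtain ⟨v, hv⟩ : (Metric.sphere (0 : EuclideanSpace ℝ (Fin 2)) (1 / 2)).Nonempty :=
      (NormedSpace.sphere_nonempty).2 (by norm_num)
    exact ⟨T' (Classical.arbitrary F', v), (Classical.arbitrary F', v), ⟨mem_univ _, hv⟩, rfl⟩
  obtain ⟨y₀, hy₀⟩ := hlevel
  simp only [mem_preimage, mem_singleton_iff] at hy₀
  haveI : Nonempty bM.carrier :=
    ⟨⟨RegularSublevel.mk hreg'.const_sub y₀ (by show 1 / 4 - g' y₀ ≤ 0; rw [hy₀]; norm_num),
      (RegularSublevel.mem_boundary_iff hreg'.const_sub _).2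
        (by show 1 / 4 - g' y₀ = 0; rw [hy₀]; norm_num)⟩⟩
  -- both pieces are connected, hence so is `P`
  haveI : ConnectedSpace cM.W :=
    connectedSpace_regularSuperlevel_tube (le_refl 2) hT'e.continuous hreg' hle' hlt' hout'
  haveI : ConnectedSpace cN.W := by
    have hpre : IsConnected (g' ⁻¹' Iic (1 / 4)) := by
      rw [preimage_Iic_eq_image_tube hle' hout']
      have hset : {x : F' × EuclideanSpace ℝ (Fin 2) | ‖x.2‖ ≤ 1 / 2} =
          (univ : Set F') ×ˢ Metric.closedBall (0 : EuclideanSpace ℝ (Fin 2)) (1 / 2) := by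
        ext x
        simp
      rw [hset]
      refine (isConnected_univ.prod (Metric.isConnected_closedBall ?_)).image _
        hT'e.continuous.continuousOn
      norm_num
    haveI : ConnectedSpace ↥(g' ⁻¹' Iic (1 / 4)) := isConnected_iff_connectedSpace.1 hpre
    exact this
  let GP' : BoundaryGluingData cM.boundaryData cN.boundaryData φ' P := GP
  haveI hconn : ConnectedSpace P := GP'.connectedSpace
  -- orientability (`OrientableBoundaryGluing.lean`)
  have hP : IsOrientableOver ℤ P 4 :=
    isOrientableOver_int_of_tube_regluing hT'e hreg' hle' hlt' hout' hY GP
  -- `|σ|` (Novikov additivity, `SignatureCupTrivialPieces.lean`)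
  have hσP : ∀ ν : HomologicalOrientation ℤ P 4, ν.signature.natAbs = n := by
    intro ν
    obtain ⟨μ⟩ := hY
    obtain ⟨μ'', h''⟩ := exists_signature_eq_of_tube_regluing hT'e hreg' hle' hlt' hout' GP μ ν
    rw [← hσ μ, ← h'']
    rcases HomologicalOrientation.eq_or_eq_neg_of_connected_holds P ν μ'' with h | h
    · rw [h]
    · rw [h, HomologicalOrientation.signature_neg_holds μ'', Int.natAbs_neg]
  -- `e` (§10)
  have heP : relEuler ℤ ℤ P ∅ = relEuler ℤ ℤ Y ∅ :=
    relEuler_eq_of_tube_regluing hT'e hreg' hle' hlt' hout' hF' GP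
  exact ⟨P, inferInstance, inferInstance, inferInstance, inferInstance, inferInstance,
    inferInstance, A, ι, hconn, hP, hσP, heP, hAeq, hιe, hιo⟩

/-- **Transport of a smooth tube through a surgery step.**  In the situation of
`akhmedovPark2010_lemma8_smooth_block_step`, a smooth tube `T₀ : F₀ × ℝᶜ → Y` with open range
missing the core `T'(F' × 0)` of the surgery tube (e.g. disjoint from `range T'`) is carried by
`ι` to a smooth tube of `P` with open range: the map `x ↦ ι (T₀ x)`.  (Akhmedov–Park 2010, §9:
"`Σ₂ = Σ₂ × (½, ½) ⊂ Y₁(1/p, 1/q)` … is disjoint from the neighborhoods of four Luttinger surgery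
tori".) [cite: AkhmedovPark2010, §9] -/
theorem akhmedovPark2010_lemma8_smooth_tube_transport {d c : ℕ}
    {Y : Type} [TopologicalSpace Y] [ChartedSpace (EuclideanSpace ℝ (Fin 4)) Y]
    [IsManifold (𝓡 4) ∞ Y]
    {P : Type} [TopologicalSpace P] [ChartedSpace (EuclideanSpace ℝ (Fin 4)) P]
    [IsManifold (𝓡 4) ∞ P]
    {F₀ : Type} [TopologicalSpace F₀] [ChartedSpace (EuclideanSpace ℝ (Fin d)) F₀]
    [IsManifold (𝓡 d) ∞ F₀]
    (A : TopologicalSpace.Opens Y) {ι : A → P}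
    (hι : Manifold.IsSmoothEmbedding (𝓡 4) (𝓡 4) ∞ ι) (hιo : IsOpen (range ι))
    {T₀ : F₀ × EuclideanSpace ℝ (Fin c) → Y}
    (hT₀ : Manifold.IsSmoothEmbedding ((𝓡 d).prod (𝓡 c)) (𝓡 4) ∞ T₀) (hT₀o : IsOpen (range T₀))
    (hA : ∀ x, T₀ x ∈ A) :
    Manifold.IsSmoothEmbedding ((𝓡 d).prod (𝓡 c)) (𝓡 4) ∞ (fun x => ι ⟨T₀ x, hA x⟩) ∧
      IsOpen (range fun x => ι ⟨T₀ x, hA x⟩) := by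
  have hg : Manifold.IsSmoothEmbedding ((𝓡 d).prod (𝓡 c)) (𝓡 4) ∞
      (fun x => (⟨T₀ x, hA x⟩ : A)) := hT₀.opensCodRestrict A hA
  have hgo : IsOpen (range fun x => (⟨T₀ x, hA x⟩ : A)) := by
    have : range (fun x => (⟨T₀ x, hA x⟩ : A)) = Subtype.val ⁻¹' range T₀ := by
      ext a
      constructor
      · rintro ⟨x, rfl⟩; exact ⟨x, rfl⟩
      · rintro ⟨x, hx⟩; exact ⟨x, Subtype.ext hx⟩
    rw [this]
    exact hT₀o.preimage continuous_subtype_val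
  obtain ⟨h1, h2⟩ :=
    isSmoothEmbedding_comp_of_isOpen_range_of_isSmoothEmbedding (k := 3) hι hιo hg
  exact ⟨h1, h2 hgo⟩

/-! ### §15′ The surgery step for the rotation regluings (Luttinger / `m`-torus surgeries) -/

/-- **A Luttinger / `(T, γ, n/1)` torus surgery step EXISTS and preserves the block data.**
`akhmedovPark2010_lemma8_smooth_block_step` for the rotation regluing
`Ψ (f, v) = (f, χ(f) · v)`, `Ψ' (f, v) = (f, χ(f)⁻¹ · v)` of a smooth map `χ : F' → S¹`
(`rotationRegluing_hypotheses`, `TubeRegluingRotation.lean`): for a closed connected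
`ℤ`-orientable smooth `4`-manifold `Y` with `|σ| = n` for all orientations and a smooth surgery
tube `T' : F' × ℝ² → Y` there is a closed connected `ℤ`-orientable smooth `P` — `Y` with `T'`
reglued by the rotation `χ` — with `|σ| = n`, `e(P) = e(Y)`, and the open smooth embedding
`ι : Y ∖ T'(F' × 0) → P`.  In Akhmedov–Park 2010 all six surgeries of `X₁(m)` have this
shape (coefficient `n/1`): the four surgeries `(a₁′ × c′, a₁′, -1)`, `(b₁′ × c″, b₁′, -1)`,
`(a₂′ × c′, c′, +1/p)`, `(a₂″ × d′, d′, +1/q)` of eq. (9.1) on `Σ₂ × T²` with `p = q = 1`, and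
the two surgeries `(α₂′ × α₃′, α₃′, -1/q)`, `(α₂″ × α₄′, α₄′, -m/r)` of eq. (4.1) on `T⁴ # ℂℙ²bar`
with `q = r = 1` — a `(T, γ, n/1)` surgery glues the new meridian to `μ_T + n γ′`, i.e. rotates the
normal circle over the torus by the `n`-th power of the angular coordinate dual to `γ`
(Baldridge–Kirk 2008 §2.2; Gompf–Stipsicz 1999 §8.3).
[cite: AkhmedovPark2010, §4 eq. (4.1) and §9 eq. (9.1)] [cite: BaldridgeKirk2008, §2.2] [cite: GompfStipsiczGSM1999, §8.3 p. 311] -/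
theorem akhmedovPark2010_lemma8_rotation_block_step
    {Y : Type} [TopologicalSpace Y] [T2Space Y] [SecondCountableTopology Y] [CompactSpace Y]
    [ConnectedSpace Y] [ChartedSpace (EuclideanSpace ℝ (Fin 4)) Y] [IsManifold (𝓡 4) ∞ Y]
    -- the surgery tube
    {F' : Type} [TopologicalSpace F'] [T2Space F'] [CompactSpace F'] [ConnectedSpace F']
    [ChartedSpace (EuclideanSpace ℝ (Fin 2)) F'] (hF' : FinRelHomology ℤ ℤ F' ∅ 4)
    {T' : F' × EuclideanSpace ℝ (Fin 2) → Y}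
    (hT' : Manifold.IsSmoothEmbedding ((𝓡 2).prod (𝓡 2)) (𝓡 4) ∞ T') (hT'o : IsOpen (range T'))
    -- the rotation
    {χ : F' → Circle} (hχ : ContMDiff (𝓡 2) (𝓡 1) ∞ χ)
    -- the numbers of `Y`
    (hY : IsOrientableOver ℤ Y 4) {n : ℕ}
    (hσ : ∀ ν : HomologicalOrientation ℤ Y 4, ν.signature.natAbs = n) :
    ∃ (P : Type) (_ : TopologicalSpace P) (_ : T2Space P) (_ : SecondCountableTopology P)
      (_ : CompactSpace P) (_ : ChartedSpace (EuclideanSpace ℝ (Fin 4)) P)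
      (_ : IsManifold (𝓡 4) ∞ P) (A : TopologicalSpace.Opens Y) (ι : A → P),
      ConnectedSpace P ∧ IsOrientableOver ℤ P 4 ∧
      (∀ ν : HomologicalOrientation ℤ P 4, ν.signature.natAbs = n) ∧
      relEuler ℤ ℤ P ∅ = relEuler ℤ ℤ Y ∅ ∧
      (A : Set Y) = (range fun f : F' => T' (f, 0))ᶜ ∧
      Manifold.IsSmoothEmbedding (𝓡 4) (𝓡 4) ∞ ι ∧ IsOpen (range ι) := by
  obtain ⟨hΨ, hΨ', hΨΨ', hΨ'Ψ, hnΨ, hnΨ', hcone⟩ := rotationRegluing_hypotheses (IF := 𝓡 2) hχ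
  exact akhmedovPark2010_lemma8_smooth_block_step hF' hT' hT'o hΨ hΨ' hΨΨ' hΨ'Ψ hnΨ hnΨ' hcone
    hY hσ

/-! ### §16 The fibre sum of two smooth blocks EXISTS with the data of §13 -/

/-- **The fibre-sum slots `(gᵢ m, X m, ψ m, G m)` of
`akhmedovPark2010_lemma8_invariants_of_blocks_vanKampen` from smooth tubes**: for smooth open
tubes `T₁ : F × ℝ² → Y₁`, `T₂ : F × ℝ² → Y₂` of one closed surface `F` (the tree's `Σ₂`:
`exists_genusTwoSurface`, `ClosedOrientableSurfaces.lean`) in two closed smooth `4`-manifolds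
there are tube functions `g₁`, `g₂` with the four tube identities, a closed smooth `4`-manifold
`X = Y₁ #_F Y₂`, a bijection `ψ` of the boundaries of the two tube complements with
`ψ(T₁(f, v)) = T₂(f, v)`, and `G : BoundaryGluingData _ _ ψ X` (`exists_fibreSum`,
`TubeFibreSum.lean`; Gompf 1995 §1).  Akhmedov–Park 2010, §9: "we take the normal connected sum
`X₁(m) = Y₁(1,1) #_ψ Z''(1,m)` … along the genus two surfaces".
[cite: AkhmedovPark2010, §9] [cite: Gompf1995, §1] -/
theorem akhmedovPark2010_lemma8_exists_fibreSum_of_smooth_blocks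
    {Y₁ : Type} [TopologicalSpace Y₁] [T2Space Y₁] [CompactSpace Y₁]
    [ChartedSpace (EuclideanSpace ℝ (Fin 4)) Y₁] [IsManifold (𝓡 4) ∞ Y₁]
    {Y₂ : Type} [TopologicalSpace Y₂] [T2Space Y₂] [CompactSpace Y₂]
    [ChartedSpace (EuclideanSpace ℝ (Fin 4)) Y₂] [IsManifold (𝓡 4) ∞ Y₂]
    {F : Type} [TopologicalSpace F] [CompactSpace F] [ConnectedSpace F]
    [ChartedSpace (EuclideanSpace ℝ (Fin 2)) F]
    {T₁ : F × EuclideanSpace ℝ (Fin 2) → Y₁} {T₂ : F × EuclideanSpace ℝ (Fin 2) → Y₂}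
    (hT₁ : Manifold.IsSmoothEmbedding ((𝓡 2).prod (𝓡 2)) (𝓡 4) ∞ T₁) (hT₁o : IsOpen (range T₁))
    (hT₂ : Manifold.IsSmoothEmbedding ((𝓡 2).prod (𝓡 2)) (𝓡 4) ∞ T₂)
    (hT₂o : IsOpen (range T₂)) :
    ∃ (g₁ : Y₁ → ℝ) (hreg₁ : IsRegularLevel (𝓡 4) g₁ (1 / 4)) (g₂ : Y₂ → ℝ)
      (hreg₂ : IsRegularLevel (𝓡 4) g₂ (1 / 4)),
      (∀ x, g₁ (T₁ x) ≤ 1 / 4 ↔ ‖x.2‖ ≤ 1 / 2) ∧ (∀ x, g₁ (T₁ x) < 1 / 4 ↔ ‖x.2‖ < 1 / 2) ∧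
      (∀ y, y ∉ range T₁ → g₁ y = 1) ∧
      (∀ x, g₂ (T₂ x) ≤ 1 / 4 ↔ ‖x.2‖ ≤ 1 / 2) ∧ (∀ x, g₂ (T₂ x) < 1 / 4 ↔ ‖x.2‖ < 1 / 2) ∧
      (∀ y, y ∉ range T₂ → g₂ y = 1) ∧
      ∃ (X : Type) (_ : TopologicalSpace X) (_ : T2Space X) (_ : SecondCountableTopology X)
        (_ : CompactSpace X) (_ : ChartedSpace (EuclideanSpace ℝ (Fin 4)) X)
        (_ : IsManifold (𝓡 4) ∞ X)
        (ψ : (RegularSublevel.boundaryData hreg₁.const_sub).carrier ≃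
          (RegularSublevel.boundaryData hreg₂.const_sub).carrier)
        (_ : BoundaryGluingData (RegularSublevel.boundaryData hreg₁.const_sub)
          (RegularSublevel.boundaryData hreg₂.const_sub) ψ X),
        ∀ (z : (RegularSublevel.boundaryData hreg₁.const_sub).carrier)
          (q : F × EuclideanSpace ℝ (Fin 2)),
          RegularSublevel.incl hreg₁.const_sub z.1 = T₁ q →
            RegularSublevel.incl hreg₂.const_sub (ψ z).1 = T₂ q := by
  haveI : Nonempty F := ConnectedSpace.toNonempty
  exact exists_fibreSum (k := 3) two_pos hT₁ hT₁o hT₂ hT₂o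

end Literature.Barriers.SmoothPoincare4
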